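import Summits.BirchSwinnertonDyer.BirchSwinnertonDyer.Theorems.PrintCFramBottomClassIndexLawFiveLeHerbrandLineRestriction
import Literature.NumberTheory.EllipticCurves.H1TrivialAction
import Literature.NumberTheory.EllipticCurves.H1UnramifiedFinite
import Literature.NumberTheory.EllipticCurves.BigRepModuleShapiroSelmerConditionsProofs
import Literature.NumberTheory.EllipticCurves.SubgroupSelmerCocycleCriteriaProofs
import Literature.NumberTheory.EllipticCurves.GreenbergVatsal2000.GreenbergSelmerGroups
import Summits.BirchSwinnertonDyer.Rank1Residual.X11b.AnticyclotomicSelmer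
import HarnessLib

/-!
# Crux `PrintCFram.BottomClassIndexLawFiveLe` (stmt-BirchSwinnertonDyer-20372), line `eisenstein-resource-bdp-line` (v10):
# Stub H, typing item T2′ — the SELMER-SIDE REDUCTION of M1 §§1–2: from the bottom-layer residual Selmer group
# `datumStrictSelmer ⊤ A p (bdpData A p 𝔭) S₀` to `θ`-equivariant continuous homomorphisms on `N = ker(Γ_K → Aut A)`
# with the local conditions

Cell `bsd-print-cfram`, width seat `bsd-line-cfram-p1-w4` (generation g5), `--supports stmt-BirchSwinnertonDyer-20372` (helper).
THEOREMS ONLY (generic continuous group cohomology + its reading on the class's objects); no definition, no named fact,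
no `sorry`. BSD is not proved by any of this; no summit statement is proved by this seat; no stub is closed.

WHAT. Stub H of the v10 skeleton (`stub_bottomResidualSelmer_trivial_of_bernoulliPair`) concludes
`datumStrictSelmer (κ.layerSubgroup 0) Φ.Sub p (AcSelmer.bdpData Φ.Sub p 𝔭) S = ⊥` (and the same for `Φ.Quot`) for a
`Γ_{K''}`-stable line `Φ ≤ W_{K''}[p]` of order `p`. Its anatomy (`Lines/herbrand-regular-locus-M1-anatomy.md`) §§1–2
unfolds this group to «classes of `H¹(K'', 𝔽_p(θ))` unramified off `S ∪ {v ∣ p}`, split at `𝔭`» and then, by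
inflation–restriction to the splitting field `L = K''(θ)` (`Γ_L = N := ker(Γ_{K''} → Aut 𝔽_p(θ))`), to «the
`[θ]`-isotypic continuous homomorphisms `Γ_L → 𝔽_p` with the same local conditions» — the object that M1 §3's class
field theory (typing item T4, LEAD g8) describes by ideles. LEAD g7's T2 (`HerbrandLineRestriction`) proved that the
restriction `H¹(Γ, A) → H¹(N, A)` is INJECTIVE. This file completes §§1–2 on the side of the Selmer CONDITIONS and
packages the result as the socket T4 plugs into:

* §1 (any topological group `G`, discrete `G`-module `M`) `cocycle_apply_conj_of_forall_smul_eq` — a continuous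
  crossed homomorphism `z` satisfies **`z(g n g⁻¹) = g • z(n)`** whenever `n` acts trivially on `M` (the
  `θ`-EQUIVARIANCE of the restricted homomorphism; with T2's character `θ` of a module of prime order this reads
  `z(g n g⁻¹) = θ(g) z(n)`, `cocycle_apply_conj_eq_character_smul`); `cocycle_apply_mul_of_forall_smul_eq` — `z` is
  ADDITIVE on such `n`; `oneCocycleClass_eq_zero_of_forall_apply_eq_zero` — if restriction to `N` is injective on
  `H¹` (`subgroupResKer M N = ⊥`) and `N` acts trivially, a class vanishes as soon as its cocycle vanishes ON `N`.
* §2 (number field `K`, normal `H ≤ Γ_K`, discrete `Γ_K`-module `M`) the LOCAL CONDITIONS DESCEND to `N`: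
  `apply_eq_zero_of_conjH1_mem_unramifiedKer` — if `conj_σ [z]` is unramified at `v` (`GreenbergVatsal2000.unramifiedKer`)
  then `z` kills every `y ∈ H` acting trivially on `M` with `σ y σ⁻¹ ∈ I_v`; `apply_eq_zero_of_conjH1_mem_strictKer_strictDatum`
  — if `conj_σ [z]` satisfies Castella's STRICT condition at `𝔭` (`AcSelmer.strictDatum`, i.e. `bdpData` at `𝔭`) then `z`
  kills every such `y` with `σ y σ⁻¹ ∈ D_𝔭`; `forall_apply_eq_zero_of_mem_datumStrictSelmer_bdpData` — both, for a
  class of `datumStrictSelmer H M p (bdpData M p 𝔭) S₀`, at every `v ∉ S₀`, `v ∤ p` and at `𝔭`.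
* §3 THE SOCKET. `datumStrictSelmer_bdpData_eq_bot_of_forall_hom` — for `M` of PRIME order `p` with continuous orbit
  maps and some element of `H` acting non-trivially (T2's hypotheses, for the group `H` itself):
  **`datumStrictSelmer H M p (bdpData M p 𝔭) S₀ = ⊥`** as soon as every continuous `f : H → M` which is additive on
  `N_H = {y ∈ H : y acts trivially}`, `H`-equivariant (`f(g y g⁻¹) = g • f(y)`), kills `N_H ∩ σ⁻¹ I_v σ` for all
  `v ∉ S₀`, `v ∤ p`, all `σ ∈ Γ_K`, and kills `N_H ∩ σ⁻¹ D_𝔭 σ` for all `σ`, vanishes on `N_H`.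
  `datumStrictSelmer_bdpData_eq_bot_of_forall_hom_of_top` — the same for `H = Γ_K` (any `H` containing every element,
  e.g. `κ.layerSubgroup 0`) with `f : Γ_K → M` and `N = ker(Γ_K → Aut M)` — exactly M1 §2's group
  `Hom_cont(Γ_L, 𝔽_p(θ))^{[θ]}` with «unramified outside `S₀ ∪ {w ∣ p}` except no condition above `p` other than:
  trivial on the decomposition groups above `𝔭`».
* The reading ON THE CLASS with Stub H's exact quantifiers (`W/ℚ` CM, `p ≥ 5` CM-ramified, `K` quadratic, `κ`,
  `𝔭 ∋ p`, any stable `Φ ≤ W_K[p]` of order `p`; T2, continuity and non-triviality discharged) is the companion file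
  `…HerbrandSelmerToHomClass.lean`.

No class field theory, no class group, no unit appears here (that is T4); no Literature fact is minted.

References: Serre, *Galois Cohomology* I.§2.3 (H¹ of a trivial module = Hom), I.§2.6 (b) (inflation–restriction),
I.§5.1 (cocycles); Greenberg, LNM 1716 (1999) §3 (residual Selmer groups of characters, PDF p. 86); Greenberg–Vatsal
2000 §2 pp. 16–17 (the local conditions place by place); Rubin, LNM 1716 Lemma 6.2 (i); the herbrand line card and
M1 memo (crux workfiles).
-/

noncomputable section

-- summit-side namespace `Summit.BirchSwinnertonDyer.BirchSwinnertonDyer.…` (single-conjunct summit, D-0017 layout)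
set_option linter.dupNamespace false
set_option autoImplicit false

open scoped Classical
open NumberField WeierstrassCurve IsDedekindDomain Field
open Literature.NumberTheory.EllipticCurves
open Literature.NumberTheory.EllipticCurves.GreenbergSelmer
open Literature.NumberTheory.EllipticCurves.GreenbergVatsal2000
open Literature.NumberTheory.GaloisRepresentations
open Summit.BirchSwinnertonDyer.Rank1Residual
open Summit.BirchSwinnertonDyer.Rank1Residual.X11b

namespace Summit.BirchSwinnertonDyer.BirchSwinnertonDyer.Theorems.PrintCFram.HerbrandSelmerToHom

/-! ## §1 Cocycles restricted to a subgroup acting trivially: additivity, equivariance, vanishing -/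

section Generic

variable {G : Type} [Group G] [TopologicalSpace G] [IsTopologicalGroup G]
variable {M : Type} [AddCommGroup M] [DistribMulAction G M] [TopologicalSpace M] [DiscreteTopology M]

omit [TopologicalSpace G] [IsTopologicalGroup G] [TopologicalSpace M] [DiscreteTopology M] in
/-- Conjugates of an element acting trivially act trivially. [folklore] -/
theorem conj_smul_eq_self_of_forall_smul_eq {n : G} (hn : ∀ m : M, n • m = m) (g : G) (m : M) :
    (g * n * g⁻¹) • m = m := by
  rw [mul_smul, mul_smul, hn (g⁻¹ • m), smul_inv_smul]

omit [IsTopologicalGroup G] in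
/-- **Additivity on the elements acting trivially.** A continuous crossed homomorphism `z : G → M` satisfies
`z(a b) = z(a) + z(b)` as soon as `a` acts trivially on `M` (the cocycle identity `z(ab) = z(a) + a • z(b)`).
[cite: SerreGaloisCohomology1997, I.§2.3 (H¹ of a trivial module)] -/
theorem cocycle_apply_mul_of_forall_smul_eq (z : contOneCocycles (discreteTopRep G M)) {a : G}
    (ha : ∀ m : M, a • m = m) (b : G) : z.1 (a * b) = z.1 a + z.1 b := by
  rw [cocycle_mul' z a b, ha]

omit [IsTopologicalGroup G] in
/-- **`θ`-equivariance of the restricted homomorphism.** A continuous crossed homomorphism `z : G → M` satisfies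
`z(g n g⁻¹) = g • z(n)` whenever `n` acts trivially on `M`: `z(g n g⁻¹) = z(g) + g • z(n) + (g n) • z(g⁻¹)` and
`(g n) • z(g⁻¹) = (g n g⁻¹) • (g • z(g⁻¹)) = g • z(g⁻¹) = −z(g)`. This is the statement that the restriction of a
class of `H¹(G, M)` to `N = ker(G → Aut M)` lies in the `G/N`-isotypic part `Hom(N, M)^{[θ]}` of M1 §2.
[cite: SerreGaloisCohomology1997, I.§2.6 (b)] [cite: GreenbergLNM1716, §3 (PDF p. 86)] -/
theorem cocycle_apply_conj_of_forall_smul_eq (z : contOneCocycles (discreteTopRep G M)) (g : G) {n : G}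
    (hn : ∀ m : M, n • m = m) : z.1 (g * n * g⁻¹) = g • z.1 n := by
  have h1 : (g * n) • z.1 g⁻¹ = -z.1 g := by
    rw [cocycle_inv' z g, smul_neg, smul_smul, conj_smul_eq_self_of_forall_smul_eq hn g]
  rw [cocycle_mul' z (g * n) g⁻¹, cocycle_mul' z g n, h1]
  abel

omit [IsTopologicalGroup G] in
/-- The same with the scalar of `g` read through a character: if `g` acts on `M` as the integer `a`
(`HerbrandLineRestriction.exists_smul_eq_zsmul_of_card_prime`, `exists_character_of_card_prime`), then
`z(g n g⁻¹) = a • z(n)` — «`f(g n g⁻¹) = θ(g) f(n)`». [cite: GreenbergLNM1716, §3 (PDF p. 86)] -/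
theorem cocycle_apply_conj_eq_zsmul (z : contOneCocycles (discreteTopRep G M)) {g : G} {a : ℤ}
    (hg : ∀ m : M, g • m = a • m) {n : G} (hn : ∀ m : M, n • m = m) : z.1 (g * n * g⁻¹) = a • z.1 n := by
  rw [cocycle_apply_conj_of_forall_smul_eq z g hn, hg]

omit [TopologicalSpace G] [IsTopologicalGroup G] [TopologicalSpace M] [DiscreteTopology M] in
/-- Membership in the kernel of the action (restated from T2 for use with dot-free rewriting):
`g ∈ ker(G → Perm M) ↔ ∀ m, g • m = m`. [folklore] -/
theorem mem_ker_toPermHom_iff' (g : G) : g ∈ (MulAction.toPermHom G M).ker ↔ ∀ m : M, g • m = m :=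
  HerbrandLineRestriction.mem_ker_toPermHom_iff g

/-- **Vanishing criterion.** If restriction `H¹(G, M) → H¹(N, M)` is injective (`subgroupResKer M N = ⊥`, T2) then the
class of a continuous crossed homomorphism `z` vanishes as soon as `z` vanishes ON `N` (its restriction is then the
principal crossed homomorphism of `0`). [cite: SerreGaloisCohomology1997, I.§5.1 and I.§2.6 (b)] -/
theorem oneCocycleClass_eq_zero_of_forall_apply_eq_zero (N : Subgroup G) (hres : subgroupResKer M N = ⊥)
    (z : contOneCocycles (discreteTopRep G M)) (hz : ∀ n : N, z.1 n = 0) :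
    oneCocycleClass (discreteTopRep G M) z = 0 := by
  have hmem : oneCocycleClass (discreteTopRep G M) z ∈ subgroupResKer M N :=
    (oneCocycleClass_mem_subgroupResKer_iff N z).2 ⟨0, fun σ ↦ by rw [hz σ, smul_zero, sub_zero]⟩
  rw [hres] at hmem
  exact AddSubgroup.mem_bot.1 hmem

/-- Conversely (no hypothesis): a vanishing class has a cocycle vanishing on every element acting trivially
(`z = ∂v`, `z(n) = n • v − v = 0`). [cite: SerreGaloisCohomology1997, I.§5.1] -/
theorem forall_apply_eq_zero_of_oneCocycleClass_eq_zero (z : contOneCocycles (discreteTopRep G M))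
    (hz : oneCocycleClass (discreteTopRep G M) z = 0) {n : G} (hn : ∀ m : M, n • m = m) : z.1 n = 0 := by
  obtain ⟨v, hv⟩ := (oneCocycleClass_eq_zero_iff _ z).1 hz
  rw [hv n]
  change n • v - v = 0
  rw [hn v, sub_self]

/-- **`H¹(G, M) = 0` from a Hom-vanishing statement.** If `subgroupResKer M N = ⊥` for `N = ker(G → Aut M)` (T2) and
every continuous `f : G → M` that is additive on `N`, `G`-equivariant on `N` (`f(g n g⁻¹) = g • f(n)`) and satisfies
a further property `P` vanishes on `N`, then every class whose cocycles satisfy `P` is zero. (The abstract shape of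
the reduction; §3 instantiates `P` with the Selmer conditions.) [cite: SerreGaloisCohomology1997, I.§2.6 (b)] -/
theorem oneCocycleClass_eq_zero_of_forall_hom (hres : subgroupResKer M (MulAction.toPermHom G M).ker = ⊥)
    (P : (G → M) → Prop)
    (hhom : ∀ f : G → M, Continuous f →
      (∀ a b : G, (∀ m : M, a • m = m) → (∀ m : M, b • m = m) → f (a * b) = f a + f b) →
      (∀ (g n : G), (∀ m : M, n • m = m) → f (g * n * g⁻¹) = g • f n) →
      P f → ∀ n : G, (∀ m : M, n • m = m) → f n = 0)
    (z : contOneCocycles (discreteTopRep G M)) (hP : P z.1) :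
    oneCocycleClass (discreteTopRep G M) z = 0 := by
  refine oneCocycleClass_eq_zero_of_forall_apply_eq_zero _ hres z fun n ↦ ?_
  exact hhom z.1 z.1.continuous (fun a b ha _ ↦ cocycle_apply_mul_of_forall_smul_eq z ha b)
    (fun g n hn ↦ cocycle_apply_conj_of_forall_smul_eq z g hn) hP n ((mem_ker_toPermHom_iff' (M := M) n.1).1 n.2)

end Generic

/-! ## §2 The local conditions descend to the kernel of the action -/

section Local

variable {K : Type} [Field K] [NumberField K]
variable (H : Subgroup (absoluteGaloisGroup K)) [H.Normal]
variable {M : Type} [AddCommGroup M] [DistribMulAction (absoluteGaloisGroup K) M] [TopologicalSpace M]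
  [DiscreteTopology M]

/-- **The unramified condition descends.** If the conjugate `conj_σ [z]` of the class of a continuous crossed
homomorphism `z : H → M` is unramified at `v` (dies on `H ⊓ I_v`, `GreenbergVatsal2000.unramifiedKer`), then `z`
kills every `y ∈ H` acting trivially on `M` with `σ y σ⁻¹ ∈ I_v` — i.e. the restricted homomorphism kills
`N ∩ σ⁻¹ I_v σ`, the inertia group of `L = K̄^N` at the place `σ⁻¹ · ṽ` (M1 §2: «unramified at `v` ⟺ the homomorphism is
unramified at every `w ∣ v`», forward direction). On cocycles: `conj_σ [z]|_{H ⊓ I_v} = 0` says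
`σ • z(σ⁻¹ x σ) = x • a − a` on `H ⊓ I_v`, and `x • a = a` for `x = σ y σ⁻¹`. [cite: GreenbergVatsal2000, §2 p. 17]
[cite: SerreGaloisCohomology1997, I.§5.1] -/
theorem apply_eq_zero_of_conjH1_mem_unramifiedKer (σ : absoluteGaloisGroup K) (v : HeightOneSpectrum (𝓞 K))
    (z : contOneCocycles (discreteTopRep H M))
    (hc : conjH1 H M σ (oneCocycleClass (discreteTopRep H M) z) ∈ GreenbergVatsal2000.unramifiedKer H M v)
    (y : H) (hy : ∀ m : M, (y : absoluteGaloisGroup K) • m = m)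
    (hyI : σ * (y : absoluteGaloisGroup K) * σ⁻¹ ∈ inertia v) : z.1 y = 0 := by
  rw [GreenbergVatsal2000.unramifiedKer, AddMonoidHom.mem_ker, conjH1_oneCocycleClass,
    CocycleCriteria.resH1Hom_oneCocycleClass_eq_zero_iff] at hc
  obtain ⟨a, ha⟩ := hc
  have hxH : σ * (y : absoluteGaloisGroup K) * σ⁻¹ ∈ H := Subgroup.Normal.conj_mem inferInstance _ y.2 σ
  have hxD : σ * (y : absoluteGaloisGroup K) * σ⁻¹ ∈ decomp v := inertia_le_decomp v hyI
  let x : inertiaIn H v := ⟨⟨σ * (y : absoluteGaloisGroup K) * σ⁻¹, hxD⟩, (mem_inertiaIn_iff H v _).2 ⟨hxH, hyI⟩⟩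
  have h := ha x
  have e : subgroupConj H σ (inertiaInToH H v x) = y := Subtype.ext (by
    rw [subgroupConj_apply_coe]
    change σ⁻¹ * (σ * (y : absoluteGaloisGroup K) * σ⁻¹) * σ = y
    group)
  have hxa : x • a = a := by
    change (σ * (y : absoluteGaloisGroup K) * σ⁻¹) • a = a
    exact conj_smul_eq_self_of_forall_smul_eq hy σ a
  rw [hxa, sub_self] at h
  change σ • z.1 (subgroupConj H σ (inertiaInToH H v x)) = 0 at h
  rw [e] at h
  exact (smul_eq_zero_iff_eq σ).1 h

omit [H.Normal] [TopologicalSpace M] [DiscreteTopology M] in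
/-- Castella's strict datum of the Summits-side `X11b.AcSelmer` is the Literature-side `Castella2018.AcSelmer` one
(same formula `M⁺_v = 0`). [folklore] -/
theorem strictDatum_eq_castella (v : HeightOneSpectrum (𝓞 K)) :
    AcSelmer.strictDatum M v = Castella2018.AcSelmer.strictDatum M v := rfl

/-- **The strict condition at `𝔭` descends.** If `conj_σ [z]` satisfies Castella's STRICT condition `M⁺_𝔭 = 0` at `𝔭`
(dies on `H ⊓ D_𝔭`; `AcSelmer.strictDatum`, the value of `bdpData` at `𝔭`), then `z` kills every `y ∈ H` acting
trivially on `M` with `σ y σ⁻¹ ∈ D_𝔭` — the restricted homomorphism kills `N ∩ σ⁻¹ D_𝔭 σ`, the decomposition group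
of `L` at the place `σ⁻¹ · 𝔭̃` (M1 §2: «locally trivial at `𝔭` ⟺ trivial on `D_w` for every `w ∣ 𝔭`», forward
direction). [cite: Greenberg1989, §1 p. 98 (the strict condition)] [cite: SerreGaloisCohomology1997, I.§5.1] -/
theorem apply_eq_zero_of_conjH1_mem_strictKer_strictDatum (σ : absoluteGaloisGroup K)
    (v : HeightOneSpectrum (𝓞 K)) (z : contOneCocycles (discreteTopRep H M))
    (hc : conjH1 H M σ (oneCocycleClass (discreteTopRep H M) z) ∈ (AcSelmer.strictDatum M v).strictKer H)
    (y : H) (hy : ∀ m : M, (y : absoluteGaloisGroup K) • m = m)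
    (hyD : σ * (y : absoluteGaloisGroup K) * σ⁻¹ ∈ decomp v) : z.1 y = 0 := by
  rw [strictDatum_eq_castella, BigGaloisRep.strictKer_strictDatum_eq_awayKer, awayKer, AddMonoidHom.mem_ker,
    BigGaloisRep.resOfLe_conjH1_oneCocycleClass_eq_zero_iff] at hc
  obtain ⟨a, ha⟩ := hc
  have hxH : σ * (y : absoluteGaloisGroup K) * σ⁻¹ ∈ H := Subgroup.Normal.conj_mem inferInstance _ y.2 σ
  let x : (H ⊓ decomp v : Subgroup (absoluteGaloisGroup K)) :=
    ⟨σ * (y : absoluteGaloisGroup K) * σ⁻¹, Subgroup.mem_inf.2 ⟨hxH, hyD⟩⟩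
  have h := ha x
  have e : subgroupConj H σ (subgroupInclusion (inf_le_left : H ⊓ decomp v ≤ H) x) = y := Subtype.ext (by
    rw [subgroupConj_apply_coe]
    change σ⁻¹ * (σ * (y : absoluteGaloisGroup K) * σ⁻¹) * σ = y
    group)
  have hxa : (x : absoluteGaloisGroup K) • a = a := conj_smul_eq_self_of_forall_smul_eq hy σ a
  rw [hxa, sub_self, e] at h
  exact (smul_eq_zero_iff_eq σ).1 h

/-- **Both local conditions of a bottom-layer residual Selmer class, read on its cocycle.** For a class `[z]` of
`datumStrictSelmer H M p (bdpData M p 𝔭) S₀` (`𝔭 ∋ p`): at every finite `v ∉ S₀` with `v ∤ p` and every `σ`,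
`z` kills the elements `y ∈ H` acting trivially on `M` with `σ y σ⁻¹ ∈ I_v`; and for every `σ`, those with
`σ y σ⁻¹ ∈ D_𝔭`. (The relaxed datum at the other places above `p` imposes nothing.)
[cite: GreenbergVatsal2000, §2 pp. 16–17, 20] [cite: Castella2018, Def. 2.2 (arXiv:1704.06608 p. 5)] -/
theorem forall_apply_eq_zero_of_mem_datumStrictSelmer_bdpData {p : ℕ} (𝔭 : HeightOneSpectrum (𝓞 K))
    (h𝔭 : ((p : ℕ) : 𝓞 K) ∈ 𝔭.asIdeal) (S₀ : Set (HeightOneSpectrum (𝓞 K)))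
    (z : contOneCocycles (discreteTopRep H M))
    (hc : oneCocycleClass (discreteTopRep H M) z ∈ datumStrictSelmer H M p (AcSelmer.bdpData M p 𝔭) S₀) :
    (∀ v : HeightOneSpectrum (𝓞 K), v ∉ S₀ → ((p : ℕ) : 𝓞 K) ∉ v.asIdeal →
        ∀ (σ : absoluteGaloisGroup K) (y : H), (∀ m : M, (y : absoluteGaloisGroup K) • m = m) →
          σ * (y : absoluteGaloisGroup K) * σ⁻¹ ∈ inertia v → z.1 y = 0) ∧
      ∀ (σ : absoluteGaloisGroup K) (y : H), (∀ m : M, (y : absoluteGaloisGroup K) • m = m) →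
        σ * (y : absoluteGaloisGroup K) * σ⁻¹ ∈ decomp 𝔭 → z.1 y = 0 := by
  rw [mem_datumStrictSelmer_iff, mem_unramifiedOutside_iff] at hc
  refine ⟨fun v hv hpv σ y hy hyI ↦ apply_eq_zero_of_conjH1_mem_unramifiedKer H σ v z (hc.1 v hv hpv σ) y hy hyI,
    fun σ y hy hyD ↦ ?_⟩
  have h := hc.2 𝔭 h𝔭 σ
  rw [AcSelmer.bdpData_self p 𝔭 h𝔭] at h
  exact apply_eq_zero_of_conjH1_mem_strictKer_strictDatum H σ 𝔭 z h y hy hyD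

end Local

/-! ## §3 The socket: `datumStrictSelmer … = ⊥` from a Hom-vanishing statement -/

section Socket

variable {K : Type} [Field K] [NumberField K] {p : ℕ} [hp : Fact p.Prime]
variable (H : Subgroup (absoluteGaloisGroup K)) [H.Normal]
variable {M : Type} [AddCommGroup M] [DistribMulAction (absoluteGaloisGroup K) M] [TopologicalSpace M]
  [DiscreteTopology M]

/-- **THE SOCKET (over `L = K̄^H`).** Let `M` be a discrete `Γ_K`-module of PRIME order `p` with continuous orbit
maps, on which some element of the normal subgroup `H` acts non-trivially (so T2 applies to the group `H`:
restriction `H¹(H, M) → H¹(N_H, M)`, `N_H = {y ∈ H : y acts trivially}`, is injective). If every continuous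
`f : H → M` which is additive and `H`-equivariant on `N_H` (`f(g y g⁻¹) = g • f(y)`), kills `N_H ∩ σ⁻¹ I_v σ` for all
finite `v ∉ S₀`, `v ∤ p`, all `σ ∈ Γ_K`, and kills `N_H ∩ σ⁻¹ D_𝔭 σ` for all `σ`, vanishes on `N_H` — then
**`datumStrictSelmer H M p (bdpData M p 𝔭) S₀ = ⊥`**. [cite: GreenbergLNM1716, §3 (PDF p. 86)]
[cite: SerreGaloisCohomology1997, I.§2.6 (b)] [cite: GreenbergVatsal2000, §2 pp. 16–17] -/
theorem datumStrictSelmer_bdpData_eq_bot_of_forall_hom (hcard : Nat.card M = p)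
    (hcont : ∀ m : M, Continuous fun g : absoluteGaloisGroup K ↦ g • m)
    (hnt : ∃ σ ∈ H, ∃ a : M, σ • a ≠ a)
    (𝔭 : HeightOneSpectrum (𝓞 K)) (h𝔭 : ((p : ℕ) : 𝓞 K) ∈ 𝔭.asIdeal) (S₀ : Set (HeightOneSpectrum (𝓞 K)))
    (hhom : ∀ f : H → M, Continuous f →
      (∀ a b : H, (∀ m : M, (a : absoluteGaloisGroup K) • m = m) → (∀ m : M, (b : absoluteGaloisGroup K) • m = m) →
        f (a * b) = f a + f b) →
      (∀ g y : H, (∀ m : M, (y : absoluteGaloisGroup K) • m = m) →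
        f (g * y * g⁻¹) = (g : absoluteGaloisGroup K) • f y) →
      (∀ v : HeightOneSpectrum (𝓞 K), v ∉ S₀ → ((p : ℕ) : 𝓞 K) ∉ v.asIdeal →
        ∀ (σ : absoluteGaloisGroup K) (y : H), (∀ m : M, (y : absoluteGaloisGroup K) • m = m) →
          σ * (y : absoluteGaloisGroup K) * σ⁻¹ ∈ inertia v → f y = 0) →
      (∀ (σ : absoluteGaloisGroup K) (y : H), (∀ m : M, (y : absoluteGaloisGroup K) • m = m) →
        σ * (y : absoluteGaloisGroup K) * σ⁻¹ ∈ decomp 𝔭 → f y = 0) →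
      ∀ y : H, (∀ m : M, (y : absoluteGaloisGroup K) • m = m) → f y = 0) :
    datumStrictSelmer H M p (AcSelmer.bdpData M p 𝔭) S₀ = ⊥ := by
  -- T2 for the topological group `H` acting on `M`
  obtain ⟨σ₀, hσ₀, a₀, ha₀⟩ := hnt
  have hres : subgroupResKer M (MulAction.toPermHom H M).ker = ⊥ :=
    HerbrandLineRestriction.subgroupResKer_ker_eq_bot_of_card_prime (G := H) hcard
      (fun a ↦ (hcont a).comp continuous_subtype_val) ⟨⟨σ₀, hσ₀⟩, a₀, ha₀⟩
  rw [eq_bot_iff]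
  intro c hc
  obtain ⟨z, rfl⟩ := oneCocycleClass_surjective _ c
  rw [AddSubgroup.mem_bot]
  obtain ⟨hU, hS⟩ := forall_apply_eq_zero_of_mem_datumStrictSelmer_bdpData H 𝔭 h𝔭 S₀ z hc
  refine oneCocycleClass_eq_zero_of_forall_hom (G := H) hres
    (fun f ↦ (∀ v : HeightOneSpectrum (𝓞 K), v ∉ S₀ → ((p : ℕ) : 𝓞 K) ∉ v.asIdeal →
        ∀ (σ : absoluteGaloisGroup K) (y : H), (∀ m : M, (y : absoluteGaloisGroup K) • m = m) →
          σ * (y : absoluteGaloisGroup K) * σ⁻¹ ∈ inertia v → f y = 0) ∧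
      ∀ (σ : absoluteGaloisGroup K) (y : H), (∀ m : M, (y : absoluteGaloisGroup K) • m = m) →
        σ * (y : absoluteGaloisGroup K) * σ⁻¹ ∈ decomp 𝔭 → f y = 0)
    (fun f hf hadd hconj hP y hy ↦ hhom f hf hadd hconj hP.1 hP.2 y hy) z ⟨hU, hS⟩

/-- **THE SOCKET OVER `K` ITSELF** (`H = Γ_K`, e.g. `H = κ.layerSubgroup 0`: any `H` containing every element), with
the homomorphisms written on `Γ_K`: for `M` of prime order `p` with continuous orbit maps and non-trivial action,
**`datumStrictSelmer H M p (bdpData M p 𝔭) S₀ = ⊥`** as soon as every continuous `f : Γ_K → M` that is additive and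
`Γ_K`-equivariant on `N = ker(Γ_K → Aut M)` (`f(g n g⁻¹) = g • f(n)` — the `[θ]`-isotypic homomorphisms on `Γ_L`,
`L = K(M)`), kills `N ∩ σ⁻¹ I_v σ` (`v ∉ S₀`, `v ∤ p`, all `σ`) and `N ∩ σ⁻¹ D_𝔭 σ` (all `σ`), vanishes on `N`. This is
M1 §2's «`R ≅ Hom(Gal(M/L), 𝔽_p)^{[θ]}`» in the direction the VANISHING of `R` needs; the Hom-side statement is
what class field theory over `L` (T4) and F1–F4 (T5) deliver. [cite: GreenbergLNM1716, §3 (PDF p. 86)]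
[cite: SerreGaloisCohomology1997, I.§2.6 (b)] [cite: GreenbergVatsal2000, §2 pp. 16–17] -/
theorem datumStrictSelmer_bdpData_eq_bot_of_forall_hom_of_top (hH : ∀ g : absoluteGaloisGroup K, g ∈ H)
    (hcard : Nat.card M = p) (hcont : ∀ m : M, Continuous fun g : absoluteGaloisGroup K ↦ g • m)
    (hnt : ∃ (σ : absoluteGaloisGroup K) (a : M), σ • a ≠ a)
    (𝔭 : HeightOneSpectrum (𝓞 K)) (h𝔭 : ((p : ℕ) : 𝓞 K) ∈ 𝔭.asIdeal) (S₀ : Set (HeightOneSpectrum (𝓞 K)))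
    (hhom : ∀ f : absoluteGaloisGroup K → M, Continuous f →
      (∀ a b : absoluteGaloisGroup K, (∀ m : M, a • m = m) → (∀ m : M, b • m = m) → f (a * b) = f a + f b) →
      (∀ g n : absoluteGaloisGroup K, (∀ m : M, n • m = m) → f (g * n * g⁻¹) = g • f n) →
      (∀ v : HeightOneSpectrum (𝓞 K), v ∉ S₀ → ((p : ℕ) : 𝓞 K) ∉ v.asIdeal →
        ∀ σ n : absoluteGaloisGroup K, (∀ m : M, n • m = m) → σ * n * σ⁻¹ ∈ inertia v → f n = 0) →
      (∀ σ n : absoluteGaloisGroup K, (∀ m : M, n • m = m) → σ * n * σ⁻¹ ∈ decomp 𝔭 → f n = 0) →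
      ∀ n : absoluteGaloisGroup K, (∀ m : M, n • m = m) → f n = 0) :
    datumStrictSelmer H M p (AcSelmer.bdpData M p 𝔭) S₀ = ⊥ := by
  obtain ⟨σ₀, a₀, ha₀⟩ := hnt
  refine datumStrictSelmer_bdpData_eq_bot_of_forall_hom H hcard hcont ⟨σ₀, hH σ₀, a₀, ha₀⟩ 𝔭 h𝔭 S₀
    fun f hf hadd hconj hU hS y hy ↦ ?_
  -- extend `f` from `H` (= everything) to `Γ_K`
  let F : absoluteGaloisGroup K → M := fun g ↦ f ⟨g, hH g⟩
  have hF : ∀ x : H, F x = f x := fun x ↦ rfl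
  have hFc : Continuous F := hf.comp (continuous_id.subtype_mk fun g ↦ hH g)
  have key := hhom F hFc (fun a b ha hb ↦ hadd ⟨a, hH a⟩ ⟨b, hH b⟩ ha hb)
    (fun g n hn ↦ hconj ⟨g, hH g⟩ ⟨n, hH n⟩ hn)
    (fun v hv hpv σ n hn hnI ↦ hU v hv hpv σ ⟨n, hH n⟩ hn hnI)
    (fun σ n hn hnD ↦ hS σ ⟨n, hH n⟩ hn hnD) y hy
  rwa [hF] at key

end Socket

end Summit.BirchSwinnertonDyer.BirchSwinnertonDyer.Theorems.PrintCFram.HerbrandSelmerToHom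

end
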